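/-
Cell b2b-lgcu-borel (gen 27).  VALUE = THEOREM (a structural law on every hypothetical witness of
the crux), NOT summit progress; the crux item `SubgroupIdentityDesigns`
(stmt-MatrixMultiplication-14079) stays open and untouched.
-/
import Mathlib
import Summits.MatrixMultiplication.MatrixMultiplication.Theorems.SubgroupIdentityDesigns.Negative.ScalarNeumannLaw

/-!
# The scalar Neumann law, central forms: the kernel in `H₁` or in `H₂`

Route `LevelGradedCohnUmans`, crux `SubgroupIdentityDesigns` (stmt-MatrixMultiplication-14079),
negative side; report `run/shared/lean/b2b/levelgraded-cu/ORACLE-g27.md` §G27-10.  VALUE = THEOREM,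
NOT summit progress; the crux item is untouched and remains open.

Companion of `ScalarNeumannLaw` (the case `K ≤ H₃`).  Same setting: a finite group `G`, a
bi-invariant test space `J ≤ ℂ^G`, a TPP triple `(H₁, H₂, H₃)` with an identity test `f ∈ J`, and now
a CENTRAL subgroup `K` of `G` of order `s` inside `H₁` or inside `H₂`.  Periodising the Neumann
probe families over `K` and counting with `card_add_card_le_finrank`:

* `K ≤ H₁`:  `|H₁ / K| · |H₃| + (|H₂| − 1) |H₃| ≤ dim J^K`     (`law_left`;  cleared: `law_left_mul`),
* `K ≤ H₂`:  `|H₁||H₃| + |H₁| (|H₂ / K| − 1) ≤ dim J^K`       (`law_middle`; cleared: `law_middle_mul`).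

In `GL_m(𝔽_p)` with `K` scalar of order `s` (`x, y, z = |H₁|, |H₂|, |H₃|`, `N_k = #{rank ≤ k}`,
`b = #ℙ(𝔽_p^m)`):

* `K ≤ H₁`, level `k`:  `x z + s (y − 1) z + 1 ≤ N_k + s`;   level one:
  `x z + s (y − 1) z + s (b − 1) ≤ (p − 1) b²`;
* `K ≤ H₂`, level `k`:  `s x z + x y + 1 ≤ N_k + s + s x`;   level one:
  `s x z + x y + s (b − 1) ≤ (p − 1) b² + s x`.

Example (`p = 13`, `m = 3`, `b = 183`, `(p − 1) b² = 401 868`): the gen-26 threshold shape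
`(x, y, z) = (312, 864, 312)` with `|H₂ ∩ Z| = 3` has `3·312·312 + 312·864 + 3·182 = 562 146 >
401 868 + 936`, so it carries no level-one witness — by this law alone.

Sorry-free; standard axioms.
-/

set_option linter.dupNamespace false

noncomputable section

open scoped BigOperators Classical
open Module (finrank)

namespace Summit.MatrixMultiplication.MatrixMultiplication.Theorems.SubgroupIdentityDesigns.Negative
namespace ScalarNeumannCentral

open Literature.Barriers.MatrixMultiplication (SubgroupTPP)
open FreeModuleLaw (invRight mem_invRight)
open Summit.MatrixMultiplication.MatrixMultiplication.Theorems.LevelTwoBeatsCubes.Negative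
  (card_add_card_le_finrank)
open ScalarNeumannLaw (quot_eq_iff out_not_mem card_eq_quot_mul word_eq_one_iff card_ne_one
  sum_ite_and_coe_eq probe_mem_invRight)

variable {G : Type} [Group G] [DecidableEq G] [Fintype G]

/-! ## Read-out of periodised probes (period in the `H₂`- or `H₁`-letter) -/

/-- `Σ_κ f(a' (u κ v) c') = [a' = 1 ∧ c' = 1] · [u⁻¹ v⁻¹ ∈ K]` (`K ≤ H₂`, `u, v ∈ H₂`). -/
theorem word_sum_middle {H₁ H₂ H₃ : Subgroup G} {f : G → ℂ} {K : Subgroup G}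
    (htpp : SubgroupTPP H₁ H₂ H₃) (h1 : f 1 = 1)
    (h0 : ∀ a ∈ H₁, ∀ b ∈ H₂, ∀ c ∈ H₃, a * b * c ≠ 1 → f (a * b * c) = 0)
    (hK : K ≤ H₂) {a' c' u v : G} (ha : a' ∈ H₁) (hc : c' ∈ H₃) (hu : u ∈ H₂) (hv : v ∈ H₂) :
    (∑ k : K, f (a' * (u * k * v) * c')) =
      if (a' = 1 ∧ c' = 1) ∧ u⁻¹ * v⁻¹ ∈ K then 1 else 0 := by
  have hterm : ∀ k : K, f (a' * (u * k * v) * c') =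
      if (a' = 1 ∧ c' = 1) ∧ (k : G) = u⁻¹ * v⁻¹ then 1 else 0 := by
    intro k
    rw [idTest_apply_eq_ite htpp h1 h0 ha (H₂.mul_mem (H₂.mul_mem hu (hK k.2)) hv) hc]
    by_cases hc : (a' = 1 ∧ c' = 1) ∧ (k : G) = u⁻¹ * v⁻¹
    · rw [if_pos hc, if_pos ⟨hc.1.1, (word_eq_one_iff u v k).2 hc.2, hc.1.2⟩]
    · rw [if_neg hc, if_neg fun h => hc ⟨⟨h.1, h.2.2⟩, (word_eq_one_iff u v k).1 h.2.1⟩]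
  simp_rw [hterm]
  exact sum_ite_and_coe_eq K _ _

/-- `Σ_κ f((u κ v) b' c') = [b' = 1 ∧ c' = 1] · [u⁻¹ v⁻¹ ∈ K]` (`K ≤ H₁`, `u, v ∈ H₁`). -/
theorem word_sum_left {H₁ H₂ H₃ : Subgroup G} {f : G → ℂ} {K : Subgroup G}
    (htpp : SubgroupTPP H₁ H₂ H₃) (h1 : f 1 = 1)
    (h0 : ∀ a ∈ H₁, ∀ b ∈ H₂, ∀ c ∈ H₃, a * b * c ≠ 1 → f (a * b * c) = 0)
    (hK : K ≤ H₁) {b' c' u v : G} (hb : b' ∈ H₂) (hc : c' ∈ H₃) (hu : u ∈ H₁) (hv : v ∈ H₁) :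
    (∑ k : K, f (u * k * v * b' * c')) =
      if (b' = 1 ∧ c' = 1) ∧ u⁻¹ * v⁻¹ ∈ K then 1 else 0 := by
  have hterm : ∀ k : K, f (u * k * v * b' * c') =
      if (b' = 1 ∧ c' = 1) ∧ (k : G) = u⁻¹ * v⁻¹ then 1 else 0 := by
    intro k
    rw [idTest_apply_eq_ite htpp h1 h0 (H₁.mul_mem (H₁.mul_mem hu (hK k.2)) hv) hb hc]
    by_cases hc : (b' = 1 ∧ c' = 1) ∧ (k : G) = u⁻¹ * v⁻¹
    · rw [if_pos hc, if_pos ⟨(word_eq_one_iff u v k).2 hc.2, hc.1.1, hc.1.2⟩]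
    · rw [if_neg hc, if_neg fun h => hc ⟨⟨h.2.1, h.2.2⟩, (word_eq_one_iff u v k).1 h.1⟩]
  simp_rw [hterm]
  exact sum_ite_and_coe_eq K _ _

/-! ## The laws -/

section Laws

variable (J : Submodule ℂ (G → ℂ)) (hJ : ∀ f ∈ J, ∀ s t : G, (fun g => f (s * g * t)) ∈ J)
  {H₁ H₂ H₃ : Subgroup G} (htpp : SubgroupTPP H₁ H₂ H₃)
  {f : G → ℂ} (hf : f ∈ J) (h1 : f 1 = 1)
  (h0 : ∀ a ∈ H₁, ∀ b ∈ H₂, ∀ c ∈ H₃, a * b * c ≠ 1 → f (a * b * c) = 0)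
include hJ htpp hf h1 h0

/-- **SCALAR NEUMANN LAW (left form).**  `K ≤ H₁` central:
`|H₁ / K| · |H₃| + (|H₂| − 1) |H₃| ≤ dim J^K`. -/
theorem law_left {K : Subgroup G} (hK : K ≤ H₁) (hcen : ∀ k ∈ K, ∀ g : G, k * g = g * k) :
    Nat.card (H₁ ⧸ K.subgroupOf H₁) * Nat.card H₃ + (Nat.card H₂ - 1) * Nat.card H₃ ≤
      finrank ℂ (invRight K J) := by
  have hl : ∀ (k : K) (c x : G), c * ((k : G) * x) = (k : G) * (c * x) := fun k c x => by
    rw [← mul_assoc, ← hcen k k.2 c, mul_assoc]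
  have hr : ∀ (k : K) (c : G), c * (k : G) = (k : G) * c := fun k c => (hcen k k.2 c).symm
  have h := card_add_card_le_finrank (A := (H₁ ⧸ K.subgroupOf H₁) × H₃)
    (S := {b : H₂ // b ≠ 1} × H₃) (invRight K J)
    (fun x => ((x.1.out : H₁) : G) * (x.2 : G)) (fun y => ((y.1 : H₂) : G) * (y.2 : G)) ?_ ?_
  · rw [Fintype.card_prod, Fintype.card_prod, card_ne_one, ← Nat.card_eq_fintype_card,
      ← Nat.card_eq_fintype_card] at h
    exact h
  · -- probes `h ↦ Σ_κ f(a₀⁻¹ h κ c₀⁻¹)`, `a₀ = out q₀`: delta on the points `a c`, zero on `b c`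
    rintro ⟨q₀, c₀⟩
    refine ⟨fun h => ∑ k : K, f (((q₀.out : H₁) : G)⁻¹ * h * (k * (c₀ : G)⁻¹)),
      probe_mem_invRight J hJ K hf _ _, ?_, ?_, ?_⟩
    · show (∑ k : K, f (((q₀.out : H₁) : G)⁻¹ * (((q₀.out : H₁) : G) * (c₀ : G)) *
        (k * (c₀ : G)⁻¹))) = 1
      have e : ∀ k : K, ((q₀.out : H₁) : G)⁻¹ * (((q₀.out : H₁) : G) * (c₀ : G)) *
          (k * (c₀ : G)⁻¹) =
          ((q₀.out : H₁) : G)⁻¹ * ((q₀.out : H₁) : G) * k * 1 * 1 * ((c₀ : G) * (c₀ : G)⁻¹) := by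
        intro k; simp only [mul_assoc, mul_one, hl, hr]
      simp_rw [e]
      rw [word_sum_left htpp h1 h0 hK H₂.one_mem (H₃.mul_mem c₀.2 (H₃.inv_mem c₀.2))
        (H₁.mul_mem (H₁.inv_mem (q₀.out).2) (q₀.out).2) H₁.one_mem, if_pos]
      refine ⟨⟨rfl, mul_inv_cancel _⟩, ?_⟩
      rw [inv_one, mul_one, mul_inv_rev, inv_inv]
      exact (quot_eq_iff q₀ q₀).2 rfl
    · rintro ⟨q, c⟩ hne
      show (∑ k : K, f (((q₀.out : H₁) : G)⁻¹ * (((q.out : H₁) : G) * (c : G)) *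
        (k * (c₀ : G)⁻¹))) = 0
      have e : ∀ k : K, ((q₀.out : H₁) : G)⁻¹ * (((q.out : H₁) : G) * (c : G)) *
          (k * (c₀ : G)⁻¹) =
          ((q₀.out : H₁) : G)⁻¹ * ((q.out : H₁) : G) * k * 1 * 1 * ((c : G) * (c₀ : G)⁻¹) := by
        intro k; simp only [mul_assoc, mul_one, hl, hr]
      simp_rw [e]
      rw [word_sum_left htpp h1 h0 hK H₂.one_mem (H₃.mul_mem c.2 (H₃.inv_mem c₀.2))
        (H₁.mul_mem (H₁.inv_mem (q₀.out).2) (q.out).2) H₁.one_mem, if_neg]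
      rintro ⟨⟨-, hc⟩, hq⟩
      rw [inv_one, mul_one, mul_inv_rev, inv_inv] at hq
      exact hne (Prod.ext ((quot_eq_iff q q₀).1 hq) (Subtype.ext (mul_inv_eq_one.1 hc)))
    · rintro ⟨b, c⟩
      show (∑ k : K, f (((q₀.out : H₁) : G)⁻¹ * (((b : H₂) : G) * (c : G)) *
        (k * (c₀ : G)⁻¹))) = 0
      have e : ∀ k : K, ((q₀.out : H₁) : G)⁻¹ * (((b : H₂) : G) * (c : G)) * (k * (c₀ : G)⁻¹) =
          ((q₀.out : H₁) : G)⁻¹ * k * 1 * ((b : H₂) : G) * ((c : G) * (c₀ : G)⁻¹) := by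
        intro k; simp only [mul_assoc, mul_one, hl, hr]
      simp_rw [e]
      rw [word_sum_left htpp h1 h0 hK (b : H₂).2 (H₃.mul_mem c.2 (H₃.inv_mem c₀.2))
        (H₁.inv_mem (q₀.out).2) H₁.one_mem, if_neg]
      rintro ⟨⟨hb, -⟩, -⟩
      exact b.2 (Subtype.ext hb)
  · -- probes `h ↦ Σ_κ f(b₀⁻¹ h κ c₀⁻¹)`: delta on the points `b c`
    rintro ⟨b₀, c₀⟩
    refine ⟨fun h => ∑ k : K, f (((b₀ : H₂) : G)⁻¹ * h * (k * (c₀ : G)⁻¹)),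
      probe_mem_invRight J hJ K hf _ _, ?_, ?_⟩
    · show (∑ k : K, f (((b₀ : H₂) : G)⁻¹ * (((b₀ : H₂) : G) * (c₀ : G)) *
        (k * (c₀ : G)⁻¹))) = 1
      have e : ∀ k : K, ((b₀ : H₂) : G)⁻¹ * (((b₀ : H₂) : G) * (c₀ : G)) * (k * (c₀ : G)⁻¹) =
          1 * k * 1 * (((b₀ : H₂) : G)⁻¹ * ((b₀ : H₂) : G)) * ((c₀ : G) * (c₀ : G)⁻¹) := by
        intro k; simp only [mul_assoc, mul_one, hl, hr]
      simp_rw [e]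
      rw [word_sum_left htpp h1 h0 hK (H₂.mul_mem (H₂.inv_mem (b₀ : H₂).2) (b₀ : H₂).2)
        (H₃.mul_mem c₀.2 (H₃.inv_mem c₀.2)) H₁.one_mem H₁.one_mem, if_pos]
      refine ⟨⟨inv_mul_cancel _, mul_inv_cancel _⟩, ?_⟩
      rw [inv_one, mul_one]
      exact K.one_mem
    · rintro ⟨b, c⟩ hne
      show (∑ k : K, f (((b₀ : H₂) : G)⁻¹ * (((b : H₂) : G) * (c : G)) *
        (k * (c₀ : G)⁻¹))) = 0
      have e : ∀ k : K, ((b₀ : H₂) : G)⁻¹ * (((b : H₂) : G) * (c : G)) * (k * (c₀ : G)⁻¹) =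
          1 * k * 1 * (((b₀ : H₂) : G)⁻¹ * ((b : H₂) : G)) * ((c : G) * (c₀ : G)⁻¹) := by
        intro k; simp only [mul_assoc, mul_one, hl, hr]
      simp_rw [e]
      rw [word_sum_left htpp h1 h0 hK (H₂.mul_mem (H₂.inv_mem (b₀ : H₂).2) (b : H₂).2)
        (H₃.mul_mem c.2 (H₃.inv_mem c₀.2)) H₁.one_mem H₁.one_mem, if_neg]
      rintro ⟨⟨hb, hc⟩, -⟩
      exact hne (Prod.ext (Subtype.ext (Subtype.ext (inv_mul_eq_one.1 hb))).symm
        (Subtype.ext (mul_inv_eq_one.1 hc)))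

/-- **SCALAR NEUMANN LAW (left form, cleared):** `|H₁||H₃| + |K| (|H₂| − 1) |H₃| ≤ |K| · dim J^K`. -/
theorem law_left_mul {K : Subgroup G} (hK : K ≤ H₁) (hcen : ∀ k ∈ K, ∀ g : G, k * g = g * k) :
    Nat.card H₁ * Nat.card H₃ + Nat.card K * ((Nat.card H₂ - 1) * Nat.card H₃) ≤
      Nat.card K * finrank ℂ (invRight K J) := by
  have h := Nat.mul_le_mul_left (Nat.card K) (law_left J hJ htpp hf h1 h0 hK hcen)
  calc Nat.card H₁ * Nat.card H₃ + Nat.card K * ((Nat.card H₂ - 1) * Nat.card H₃)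
      = Nat.card K * (Nat.card (H₁ ⧸ K.subgroupOf H₁) * Nat.card H₃ +
          (Nat.card H₂ - 1) * Nat.card H₃) := by rw [card_eq_quot_mul hK]; ring
    _ ≤ _ := h

/-- **SCALAR NEUMANN LAW (middle form).**  `K ≤ H₂` central:
`|H₁||H₃| + |H₁| (|H₂ / K| − 1) ≤ dim J^K`. -/
theorem law_middle {K : Subgroup G} (hK : K ≤ H₂) (hcen : ∀ k ∈ K, ∀ g : G, k * g = g * k) :
    Nat.card H₁ * Nat.card H₃ + Nat.card H₁ * (Nat.card (H₂ ⧸ K.subgroupOf H₂) - 1) ≤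
      finrank ℂ (invRight K J) := by
  have hl : ∀ (k : K) (c x : G), c * ((k : G) * x) = (k : G) * (c * x) := fun k c x => by
    rw [← mul_assoc, ← hcen k k.2 c, mul_assoc]
  have hr : ∀ (k : K) (c : G), c * (k : G) = (k : G) * c := fun k c => (hcen k k.2 c).symm
  have h := card_add_card_le_finrank (A := H₁ × H₃)
    (S := H₁ × {q : H₂ ⧸ K.subgroupOf H₂ // q ≠ ((1 : H₂) : H₂ ⧸ K.subgroupOf H₂)})
    (invRight K J)
    (fun x => (x.1 : G) * (x.2 : G)) (fun y => (y.1 : G) * ((y.2.1.out : H₂) : G)) ?_ ?_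
  · rw [Fintype.card_prod, Fintype.card_prod, Fintype.card_subtype_compl,
      Fintype.card_subtype_eq, ← Nat.card_eq_fintype_card, ← Nat.card_eq_fintype_card,
      ← Nat.card_eq_fintype_card] at h
    exact h
  · -- probes `h ↦ Σ_κ f(a₀⁻¹ h κ c₀⁻¹)`: delta on the points `a c`, zero on `a b` (`b ∉ K`)
    rintro ⟨a₀, c₀⟩
    refine ⟨fun h => ∑ k : K, f ((a₀ : G)⁻¹ * h * (k * (c₀ : G)⁻¹)),
      probe_mem_invRight J hJ K hf _ _, ?_, ?_, ?_⟩
    · show (∑ k : K, f ((a₀ : G)⁻¹ * ((a₀ : G) * (c₀ : G)) * (k * (c₀ : G)⁻¹))) = 1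
      have e : ∀ k : K, (a₀ : G)⁻¹ * ((a₀ : G) * (c₀ : G)) * (k * (c₀ : G)⁻¹) =
          (a₀ : G)⁻¹ * (a₀ : G) * (1 * k * 1) * ((c₀ : G) * (c₀ : G)⁻¹) := by
        intro k; simp only [mul_assoc, mul_one, hl, hr]
      simp_rw [e]
      rw [word_sum_middle htpp h1 h0 hK (H₁.mul_mem (H₁.inv_mem a₀.2) a₀.2)
        (H₃.mul_mem c₀.2 (H₃.inv_mem c₀.2)) H₂.one_mem H₂.one_mem, if_pos]
      refine ⟨⟨inv_mul_cancel _, mul_inv_cancel _⟩, ?_⟩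
      rw [inv_one, mul_one]
      exact K.one_mem
    · rintro ⟨a, c⟩ hne
      show (∑ k : K, f ((a₀ : G)⁻¹ * ((a : G) * (c : G)) * (k * (c₀ : G)⁻¹))) = 0
      have e : ∀ k : K, (a₀ : G)⁻¹ * ((a : G) * (c : G)) * (k * (c₀ : G)⁻¹) =
          (a₀ : G)⁻¹ * (a : G) * (1 * k * 1) * ((c : G) * (c₀ : G)⁻¹) := by
        intro k; simp only [mul_assoc, mul_one, hl, hr]
      simp_rw [e]
      rw [word_sum_middle htpp h1 h0 hK (H₁.mul_mem (H₁.inv_mem a₀.2) a.2)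
        (H₃.mul_mem c.2 (H₃.inv_mem c₀.2)) H₂.one_mem H₂.one_mem, if_neg]
      rintro ⟨⟨ha, hc⟩, -⟩
      exact hne (Prod.ext (Subtype.ext (inv_mul_eq_one.1 ha)).symm
        (Subtype.ext (mul_inv_eq_one.1 hc)))
    · rintro ⟨a, q⟩
      show (∑ k : K, f ((a₀ : G)⁻¹ * ((a : G) * ((q.1.out : H₂) : G)) * (k * (c₀ : G)⁻¹))) = 0
      have e : ∀ k : K, (a₀ : G)⁻¹ * ((a : G) * ((q.1.out : H₂) : G)) * (k * (c₀ : G)⁻¹) =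
          (a₀ : G)⁻¹ * (a : G) * (((q.1.out : H₂) : G) * k * 1) * (c₀ : G)⁻¹ := by
        intro k; simp only [mul_assoc, mul_one, hl, hr]
      simp_rw [e]
      rw [word_sum_middle htpp h1 h0 hK (H₁.mul_mem (H₁.inv_mem a₀.2) a.2)
        (H₃.inv_mem c₀.2) (q.1.out).2 H₂.one_mem, if_neg]
      rintro ⟨-, hq⟩
      rw [inv_one, mul_one, inv_mem_iff] at hq
      exact out_not_mem q.2 hq
  · -- probes `h ↦ Σ_κ f(a₀⁻¹ h κ b₀⁻¹)`, `b₀ = out q₀`: delta on the points `a b`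
    rintro ⟨a₀, q₀⟩
    refine ⟨fun h => ∑ k : K, f ((a₀ : G)⁻¹ * h * (k * ((q₀.1.out : H₂) : G)⁻¹)),
      probe_mem_invRight J hJ K hf _ _, ?_, ?_⟩
    · show (∑ k : K, f ((a₀ : G)⁻¹ * ((a₀ : G) * ((q₀.1.out : H₂) : G)) *
        (k * ((q₀.1.out : H₂) : G)⁻¹))) = 1
      have e : ∀ k : K, (a₀ : G)⁻¹ * ((a₀ : G) * ((q₀.1.out : H₂) : G)) *
          (k * ((q₀.1.out : H₂) : G)⁻¹) =
          (a₀ : G)⁻¹ * (a₀ : G) * (((q₀.1.out : H₂) : G) * k * ((q₀.1.out : H₂) : G)⁻¹) * 1 := by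
        intro k; simp only [mul_assoc, mul_one, hl, hr]
      simp_rw [e]
      rw [word_sum_middle htpp h1 h0 hK (H₁.mul_mem (H₁.inv_mem a₀.2) a₀.2) H₃.one_mem
        (q₀.1.out).2 (H₂.inv_mem (q₀.1.out).2), if_pos]
      exact ⟨⟨inv_mul_cancel _, rfl⟩, by rw [inv_inv]; exact (quot_eq_iff q₀.1 q₀.1).2 rfl⟩
    · rintro ⟨a, q⟩ hne
      show (∑ k : K, f ((a₀ : G)⁻¹ * ((a : G) * ((q.1.out : H₂) : G)) *
        (k * ((q₀.1.out : H₂) : G)⁻¹))) = 0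
      have e : ∀ k : K, (a₀ : G)⁻¹ * ((a : G) * ((q.1.out : H₂) : G)) *
          (k * ((q₀.1.out : H₂) : G)⁻¹) =
          (a₀ : G)⁻¹ * (a : G) * (((q.1.out : H₂) : G) * k * ((q₀.1.out : H₂) : G)⁻¹) * 1 := by
        intro k; simp only [mul_assoc, mul_one, hl, hr]
      simp_rw [e]
      rw [word_sum_middle htpp h1 h0 hK (H₁.mul_mem (H₁.inv_mem a₀.2) a.2) H₃.one_mem
        (q.1.out).2 (H₂.inv_mem (q₀.1.out).2), if_neg]
      rintro ⟨⟨ha, -⟩, hq⟩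
      rw [inv_inv] at hq
      exact hne (Prod.ext (Subtype.ext (inv_mul_eq_one.1 ha)).symm
        (Subtype.ext ((quot_eq_iff q.1 q₀.1).1 hq)))

/-- **SCALAR NEUMANN LAW (middle form, cleared):**
`|K| |H₁||H₃| + |H₁||H₂| ≤ |K| · dim J^K + |K| |H₁|`. -/
theorem law_middle_mul {K : Subgroup G} (hK : K ≤ H₂) (hcen : ∀ k ∈ K, ∀ g : G, k * g = g * k) :
    Nat.card K * (Nat.card H₁ * Nat.card H₃) + Nat.card H₁ * Nat.card H₂ ≤
      Nat.card K * finrank ℂ (invRight K J) + Nat.card K * Nat.card H₁ := by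
  have h := Nat.mul_le_mul_left (Nat.card K) (law_middle J hJ htpp hf h1 h0 hK hcen)
  have hQ : 1 ≤ Nat.card (H₂ ⧸ K.subgroupOf H₂) := Nat.one_le_iff_ne_zero.2 Nat.card_pos.ne'
  have e : Nat.card H₁ * (Nat.card (H₂ ⧸ K.subgroupOf H₂) - 1) + Nat.card H₁ =
      Nat.card H₁ * Nat.card (H₂ ⧸ K.subgroupOf H₂) := by
    rw [Nat.mul_sub_one, Nat.sub_add_cancel (Nat.le_mul_of_pos_right _ hQ)]
  have e2 : Nat.card H₁ * Nat.card H₂ =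
      Nat.card K * (Nat.card H₁ * (Nat.card (H₂ ⧸ K.subgroupOf H₂) - 1)) +
        Nat.card K * Nat.card H₁ := by
    rw [← mul_add, e, card_eq_quot_mul hK]; ring
  rw [e2, ← add_assoc, ← mul_add]
  exact Nat.add_le_add_right h _

end Laws

/-! ## `GL_m(𝔽_p)`: scalar subgroups of `H₁` and of `H₂` -/

section Linear

open scoped LinearAlgebra.Projectivization
open Summit.MatrixMultiplication.MatrixMultiplication.Theorems.LieRankDesigns.Negative (GLm Mat)
open Summit.MatrixMultiplication.MatrixMultiplication.Theorems.LevelOneGL2Designs.Negative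
  (levelSubmodule levelSubmodule_bi_inv)
open PackingBridge (exists_test)
open ScalarBlockLaw (central_of_le_range semiregular_of_le_range)
open ScalarBlockLevel (card_mul_finrank_invRight_le semiregular_modes_of_le_range)

variable {p m : ℕ} [hp : Fact p.Prime] {k : ℕ}

/-- **EVERY LEVEL `k`, left form.**  Scalar `K ≤ H₁` of order `s`: `x z + s (y − 1) z + 1 ≤ N_k + s`. -/
theorem levelK_left {H₁ H₂ H₃ : Subgroup (GLm p m)} (htpp : SubgroupTPP H₁ H₂ H₃)
    (hdes : ∃ c : Mat p m → ℂ, (∀ M, k < M.rank → c M = 0) ∧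
      (∑ M, c M * ZMod.stdAddChar (Matrix.trace (M * ((1 : GLm p m) : Mat p m)))) = 1 ∧
      ∀ a ∈ H₁, ∀ b ∈ H₂, ∀ g ∈ H₃, a * b * g ≠ 1 →
        (∑ M, c M * ZMod.stdAddChar (Matrix.trace (M * ((a * b * g : GLm p m) : Mat p m)))) = 0)
    {K : Subgroup (GLm p m)} (hK : K ≤ H₁) (hKZ : K ≤ (scalarHom p m).range) :
    Nat.card H₁ * Nat.card H₃ + Nat.card K * ((Nat.card H₂ - 1) * Nat.card H₃) + 1 ≤
      Fintype.card {M : Mat p m // M.rank ≤ k} + Nat.card K := by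
  obtain ⟨f, hf, h1, h0⟩ := exists_test hdes
  have h := law_left_mul (levelSubmodule p m k) levelSubmodule_bi_inv htpp hf h1 h0 hK
    (central_of_le_range hKZ)
  have hdim := card_mul_finrank_invRight_le (k := k) K (semiregular_modes_of_le_range hKZ)
  omega

/-- **LEVEL ONE, left form.**  Scalar `K ≤ H₁` of order `s` (`m ≥ 1`):
`x z + s (y − 1) z + s (b − 1) ≤ (p − 1) b²`. -/
theorem levelOne_left (hm : 1 ≤ m) {H₁ H₂ H₃ : Subgroup (GLm p m)}
    (htpp : SubgroupTPP H₁ H₂ H₃)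
    (hdes : ∃ c : Mat p m → ℂ, (∀ M, 1 < M.rank → c M = 0) ∧
      (∑ M, c M * ZMod.stdAddChar (Matrix.trace (M * ((1 : GLm p m) : Mat p m)))) = 1 ∧
      ∀ a ∈ H₁, ∀ b ∈ H₂, ∀ g ∈ H₃, a * b * g ≠ 1 →
        (∑ M, c M * ZMod.stdAddChar (Matrix.trace (M * ((a * b * g : GLm p m) : Mat p m)))) = 0)
    {K : Subgroup (GLm p m)} (hK : K ≤ H₁) (hKZ : K ≤ (scalarHom p m).range) :
    Nat.card H₁ * Nat.card H₃ + Nat.card K * ((Nat.card H₂ - 1) * Nat.card H₃) +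
        Nat.card K * (Nat.card (ℙ (ZMod p) (Fin m → ZMod p)) - 1) ≤
      (p - 1) * Nat.card (ℙ (ZMod p) (Fin m → ZMod p)) ^ 2 := by
  obtain ⟨f, hf, h1, h0⟩ := exists_test hdes
  have h := law_left_mul (levelSubmodule p m 1) levelSubmodule_bi_inv htpp hf h1 h0 hK
    (central_of_le_range hKZ)
  have hdim := LevelOneInvariantDim.card_mul_finrank_le_of_semiregular hm K
    (semiregular_of_le_range hKZ)
  exact le_trans (Nat.add_le_add_right h _) hdim

/-- **EVERY LEVEL `k`, middle form.**  Scalar `K ≤ H₂` of order `s`: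
`s x z + x y + 1 ≤ N_k + s + s x`. -/
theorem levelK_middle {H₁ H₂ H₃ : Subgroup (GLm p m)} (htpp : SubgroupTPP H₁ H₂ H₃)
    (hdes : ∃ c : Mat p m → ℂ, (∀ M, k < M.rank → c M = 0) ∧
      (∑ M, c M * ZMod.stdAddChar (Matrix.trace (M * ((1 : GLm p m) : Mat p m)))) = 1 ∧
      ∀ a ∈ H₁, ∀ b ∈ H₂, ∀ g ∈ H₃, a * b * g ≠ 1 →
        (∑ M, c M * ZMod.stdAddChar (Matrix.trace (M * ((a * b * g : GLm p m) : Mat p m)))) = 0)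
    {K : Subgroup (GLm p m)} (hK : K ≤ H₂) (hKZ : K ≤ (scalarHom p m).range) :
    Nat.card K * (Nat.card H₁ * Nat.card H₃) + Nat.card H₁ * Nat.card H₂ + 1 ≤
      Fintype.card {M : Mat p m // M.rank ≤ k} + Nat.card K + Nat.card K * Nat.card H₁ := by
  obtain ⟨f, hf, h1, h0⟩ := exists_test hdes
  have h := law_middle_mul (levelSubmodule p m k) levelSubmodule_bi_inv htpp hf h1 h0 hK
    (central_of_le_range hKZ)
  have hdim := card_mul_finrank_invRight_le (k := k) K (semiregular_modes_of_le_range hKZ)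
  omega

/-- **LEVEL ONE, middle form.**  Scalar `K ≤ H₂` of order `s` (`m ≥ 1`):
`s x z + x y + s (b − 1) ≤ (p − 1) b² + s x`. -/
theorem levelOne_middle (hm : 1 ≤ m) {H₁ H₂ H₃ : Subgroup (GLm p m)}
    (htpp : SubgroupTPP H₁ H₂ H₃)
    (hdes : ∃ c : Mat p m → ℂ, (∀ M, 1 < M.rank → c M = 0) ∧
      (∑ M, c M * ZMod.stdAddChar (Matrix.trace (M * ((1 : GLm p m) : Mat p m)))) = 1 ∧
      ∀ a ∈ H₁, ∀ b ∈ H₂, ∀ g ∈ H₃, a * b * g ≠ 1 →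
        (∑ M, c M * ZMod.stdAddChar (Matrix.trace (M * ((a * b * g : GLm p m) : Mat p m)))) = 0)
    {K : Subgroup (GLm p m)} (hK : K ≤ H₂) (hKZ : K ≤ (scalarHom p m).range) :
    Nat.card K * (Nat.card H₁ * Nat.card H₃) + Nat.card H₁ * Nat.card H₂ +
        Nat.card K * (Nat.card (ℙ (ZMod p) (Fin m → ZMod p)) - 1) ≤
      (p - 1) * Nat.card (ℙ (ZMod p) (Fin m → ZMod p)) ^ 2 + Nat.card K * Nat.card H₁ := by
  obtain ⟨f, hf, h1, h0⟩ := exists_test hdes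
  have h := law_middle_mul (levelSubmodule p m 1) levelSubmodule_bi_inv htpp hf h1 h0 hK
    (central_of_le_range hKZ)
  have hdim := LevelOneInvariantDim.card_mul_finrank_le_of_semiregular hm K
    (semiregular_of_le_range hKZ)
  omega

end Linear

end ScalarNeumannCentral
end Summit.MatrixMultiplication.MatrixMultiplication.Theorems.SubgroupIdentityDesigns.Negative

end
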